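import Literature.Probability.RandomPlanarGeometry.HexParafermionProofs
import Literature.Probability.RandomPlanarGeometry.SAWEdgeListSurgery

/-!
# Concatenating walks at a door, and additivity of the winding

Helper file for the crux `NoFoldBound` (stmt-CriticalPhenomena-8296) of the route `SAWDevelopingMap`
(sub-problem `SAWScalingLimit` of `CriticalPhenomena`), programme FLAT / PEELED LP of the lead seats
c9–c10 (`FLAT-LEAN-DESIGN.md` on the item, §L2(iii)), brick L2(iii-a). The far phases of the peeled
linear programme are obtained WITHOUT parametric witness walks: a walk `γ` of the peeled domain
`Λ ∖ K` from a local door `{p, q}` (`p ∈ K`, `q ∉ K`) is prefixed by a fixed walk `π` of `Λ` from the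
standard entrance `a` to the door `{p, q}` running inside `K`; the concatenation is a walk of `Λ`
from `a`, whose winding the tree knows (`HV.pturn_of_isAlphaDart / IsBetaDart / IsEpsDart` after
`HexMidEdgeSAW.winding_eq_pturn_code`), and the winding is additive at the door. This file proves
the two walk-level facts:

* `exists_concat` — gluing: `π : a → {p,q}` inside `K ⊆ Λ` ending at `p`, and
  `γ : {p,q} → z` in `Λ ∖ K`, give a walk `Γ : a → z` of `Λ` with `Γ.verts = π.verts ++ γ.verts`;
* `winding_concat` — for any such `Γ`, `W(Γ) = W(π) + W(γ)`: the two half-segments of the door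
  extend to the full segment `[c p, c q]` (`winding_concat_right_ray`, `winding_cons_left_ray`), at
  which the polyline winding is additive (`winding_append_cons_cons`).
-/

noncomputable section

open scoped Classical
open Literature.Probability.LatticeModels Literature.Probability.RandomPlanarGeometry.SAW

namespace Summit.CriticalPhenomena.SAWScalingLimit.Theorems.SAWDevelopingMapNoFoldBound.Peel

variable {Λ K : Finset HexVertex} {a z : Sym2 HexVertex} {p q : HexVertex}

/-- The last vertex of a prefix walk to the door `{p, q}` that avoids `q` is `p`. -/
theorem getLast_eq_of_notMem (π : HexMidEdgeSAW Λ a s(p, q)) (hne : π.verts ≠ [])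
    (hq : q ∉ π.verts) : π.verts.getLast hne = p := by
  rcases π.getLast_eq_or hne with h | h
  · exact h
  · have hm := List.getLast_mem hne
    rw [h] at hm
    exact absurd hm hq

/-- **Gluing at a door.** Let `π` be a nontrivial walk of `Λ` from `a` to the mid-edge `{p, q}` with all
its vertices in `K`, `q ∉ K`, and `γ` a walk of `Λ ∖ K` from the door `{p, q}` to `z` which is not
one of the mid-edges used by `π`. Then `π.verts ++ γ.verts` is a walk of `Λ` from `a` to `z`. -/
theorem exists_concat : ∀ {Λ K : Finset HexVertex} {a z : Sym2 HexVertex} {p q : HexVertex} (π : HexMidEdgeSAW Λ a s(p, q)) (γ : HexMidEdgeSAW (Λ \ K) s(p, q) z), π.verts ≠ [] → (∀ v ∈ π.verts, v ∈ K) → q ∉ K → q ∈ Λ → hexGraph.Adj p q → (∀ v ∈ z, v ∉ K) → (∀ v ∈ a, v ∈ Λ → v ∈ K) → γ.verts ≠ [] → ∃ Γ : HexMidEdgeSAW Λ a z, Γ.verts = π.verts ++ γ.verts := by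
  intro Λ K a z p q π γ hπ hK hqK hqΛ hpq hzK haK hγ
  have hqπ : q ∉ π.verts := fun h => hqK (hK q h)
  have hlast : π.verts.getLast hπ = p := getLast_eq_of_notMem π hπ hqπ
  have hpK : p ∈ K := by
    have hm := List.getLast_mem hπ
    rw [hlast] at hm
    exact hK p hm
  -- `γ` starts at `q`
  have hpD : p ∉ Λ \ K := fun h => (Finset.mem_sdiff.1 h).2 hpK
  have hhead : γ.verts.head hγ = q := γ.head_eq rfl hpD hγ
  obtain ⟨l, hl⟩ : ∃ l, γ.verts = q :: l := by
    obtain ⟨x, l, hx⟩ := List.exists_cons_of_ne_nil hγ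
    have : x = q := by rw [← hhead]; simp [hx]
    exact ⟨l, this ▸ hx⟩
  obtain ⟨π₀, hπ₀⟩ : ∃ π₀, π.verts = π₀ ++ [p] :=
    ⟨π.verts.dropLast, by conv_lhs => rw [← List.dropLast_append_getLast hπ, hlast]⟩
  -- vertices of `γ` are in `Λ ∖ K`
  have hγD : ∀ v ∈ γ.verts, v ∈ Λ ∧ v ∉ K := fun v hv => Finset.mem_sdiff.1 (γ.subset v hv)
  refine ⟨⟨π.verts ++ γ.verts, ?_, ?_, ?_, ?_, ?_, ?_, fun _ => ?_, π.fst_mem⟩, rfl⟩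
  · -- subset
    intro v hv
    rcases List.mem_append.1 hv with hv | hv
    · exact π.subset v hv
    · exact (hγD v hv).1
  · -- nodup
    rw [List.nodup_append]
    exact ⟨π.nodup, γ.nodup, fun x hx y hy hxy => (hγD y hy).2 (hxy ▸ hK x hx)⟩
  · -- chain
    rw [List.isChain_append]
    refine ⟨π.isChain, γ.isChain, fun x hx y hy => ?_⟩
    rw [List.getLast?_eq_some_getLast hπ, Option.mem_def, Option.some.injEq] at hx
    rw [hl, List.head?_cons, Option.mem_def, Option.some.injEq] at hy
    rw [← hx, ← hy, hlast]; exact hpq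
  · -- head
    intro v hv
    refine π.head_mem v ?_
    rw [List.head?_append, List.head?_eq_some_head hπ] at hv
    rw [List.head?_eq_some_head hπ]; simpa using hv
  · -- last
    intro v hv
    refine γ.getLast_mem v ?_
    rwa [List.getLast?_append_of_ne_nil _ hγ] at hv
  · intro h; simp [hγ] at h
  · -- edges: `a :: edges(π₀ ++ [p]) ++ {p,q} :: edges(q :: l) ++ [z]`
    have heπ := π.edges_nodup hπ
    have heγ := γ.edges_nodup hγ
    rw [hπ₀] at heπ
    rw [hl] at heγ
    have hsplit : List.zipWith (fun u w => s(u, w)) (π.verts ++ γ.verts) (π.verts ++ γ.verts).tail =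
        List.zipWith (fun u w => s(u, w)) (π₀ ++ [p]) (π₀ ++ [p]).tail ++
          (s(p, q) :: List.zipWith (fun u w => s(u, w)) (q :: l) (q :: l).tail) := by
      rw [hπ₀, hl, List.append_assoc, List.singleton_append, edges_append_cons π₀ p (q :: l),
        edges_cons_cons]
    rw [hsplit]
    -- the combined list is `(a :: Eπ) ++ ({p,q} :: Eγ ++ [z])`
    have e : a :: (List.zipWith (fun u w => s(u, w)) (π₀ ++ [p]) (π₀ ++ [p]).tail ++
        s(p, q) :: List.zipWith (fun u w => s(u, w)) (q :: l) (q :: l).tail) ++ [z] =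
        (a :: List.zipWith (fun u w => s(u, w)) (π₀ ++ [p]) (π₀ ++ [p]).tail) ++
          (s(p, q) :: List.zipWith (fun u w => s(u, w)) (q :: l) (q :: l).tail ++ [z]) := by
      simp
    rw [e, List.nodup_append]
    refine ⟨?_, heγ, ?_⟩
    · -- `a :: Eπ` is a sublist of `a :: Eπ ++ [{p,q}]`
      exact heπ.sublist (by simp)
    · -- disjointness: every edge on the right has a vertex in `Λ ∖ K` (or is `z`), none on the left
      intro x hx y hy hxy
      subst hxy
      -- `x` is `a` or an edge of `π₀ ++ [p]`: all its vertices in `Λ` are in `K`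
      have hxK : ∀ v ∈ x, v ∈ Λ → v ∈ K := by
        rcases List.mem_cons.1 hx with rfl | hx
        · exact haK
        · intro v hv _
          exact hK v (hπ₀ ▸ forall_mem_of_mem_edges _ _ hx v hv)
      rcases List.mem_cons.1 hy with rfl | hy
      · -- `x = {p,q}`: `q ∈ Λ ∖ K`
        exact hqK (hxK q (Sym2.mem_mk_right p q) hqΛ)
      rcases List.mem_append.1 hy with hy | hy
      · -- an edge of `γ`: its first vertex is in `Λ ∖ K`
        obtain ⟨i, hi, rfl⟩ := mem_edges_iff.1 hy
        have hm : (q :: l)[i] ∈ γ.verts := by rw [hl]; exact List.getElem_mem _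
        exact (hγD _ hm).2 (hxK _ (Sym2.mem_mk_left _ _) (hγD _ hm).1)
      · -- `x = z`: the last vertex of `γ` is in `z` and in `Λ ∖ K`
        rw [List.mem_singleton] at hy
        subst hy
        have hm : γ.verts.getLast hγ ∈ γ.verts := List.getLast_mem hγ
        have hz := γ.getLast_mem (γ.verts.getLast hγ) (List.getLast?_eq_some_getLast hγ)
        exact hzK _ hz (hxK _ hz (hγD _ hm).1)

/-- **Additivity of the winding at a door.** For walks `π : a → {p,q}` ending at `p` (not visiting
`q`) and `γ : {p,q} → z` starting at `q` (i.e. `p` outside its domain), and any walk `Γ` with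
`Γ.verts = π.verts ++ γ.verts`: `W(Γ) = W(π) + W(γ)`. -/
theorem winding_concat : ∀ {Λ Λ' Λ'' : Finset HexVertex} {a z : Sym2 HexVertex} {p q : HexVertex} (π : HexMidEdgeSAW Λ' a s(p, q)) (γ : HexMidEdgeSAW Λ'' s(p, q) z) (Γ : HexMidEdgeSAW Λ a z), π.verts ≠ [] → q ∉ π.verts → p ∉ Λ'' → γ.verts ≠ [] → Γ.verts = π.verts ++ γ.verts → Γ.winding = π.winding + γ.winding := by
  intro Λ Λ' Λ'' a z p q π γ Γ hπ hqπ hp hγ hΓ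
  have hlast : π.verts.getLast hπ = p := getLast_eq_of_notMem π hπ hqπ
  have hhead : γ.verts.head hγ = q := γ.head_eq rfl hp hγ
  obtain ⟨l, hl⟩ : ∃ l, γ.verts = q :: l := by
    obtain ⟨x, l, hx⟩ := List.exists_cons_of_ne_nil hγ
    have : x = q := by rw [← hhead]; simp [hx]
    exact ⟨l, this ▸ hx⟩
  obtain ⟨π₀, hπ₀⟩ : ∃ π₀, π.verts = π₀ ++ [p] :=
    ⟨π.verts.dropLast, by conv_lhs => rw [← List.dropLast_append_getLast hπ, hlast]⟩
  -- the three polylines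
  have hmid : hexMidpoint s(p, q) = (hexCenter p + hexCenter q) / 2 := hexMidpoint_mk p q
  have eΓ : Γ.points = (hexMidpoint a :: π₀.map hexCenter) ++
      hexCenter p :: hexCenter q :: (l.map hexCenter ++ [hexMidpoint z]) := by
    simp [HexMidEdgeSAW.points, hΓ, hπ₀, hl]
  have emid1 : hexMidpoint s(p, q) = hexCenter p + (1 / 2 : ℝ) * (hexCenter q - hexCenter p) := by
    rw [hmid]; push_cast; ring
  have emid2 : hexMidpoint s(p, q) = hexCenter q + (1 / 2 : ℝ) * (hexCenter p - hexCenter q) := by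
    rw [hmid]; push_cast; ring
  have eπ : π.points = (hexMidpoint a :: π₀.map hexCenter) ++
      [hexCenter p, hexCenter p + (1 / 2 : ℝ) * (hexCenter q - hexCenter p)] := by
    rw [← emid1]
    simp [HexMidEdgeSAW.points, hπ₀]
  have eγ : γ.points = (hexCenter q + (1 / 2 : ℝ) * (hexCenter p - hexCenter q)) :: hexCenter q ::
      (l.map hexCenter ++ [hexMidpoint z]) := by
    rw [← emid2]
    simp [HexMidEdgeSAW.points, hl]
  rw [HexMidEdgeSAW.winding, HexMidEdgeSAW.winding, HexMidEdgeSAW.winding, eΓ, eπ, eγ,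
    winding_append_cons_cons, winding_concat_right_ray (by norm_num : (0 : ℝ) < 1 / 2),
    winding_cons_left_ray (by norm_num : (0 : ℝ) < 1 / 2)]

end Summit.CriticalPhenomena.SAWScalingLimit.Theorems.SAWDevelopingMapNoFoldBound.Peel
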